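import Summits.KontsevichZagierPeriods.KontsevichZagierPeriods.Theorems.LinRedNormalFormHoffmanSpanInKZEdsDSRows
import Summits.KontsevichZagierPeriods.KontsevichZagierPeriods.Theorems.LinRedNormalFormHoffmanSpanInKZEdsDSLeafOfOddDet

/-!
# Crux `LinRedNormalForm.HoffmanSpanInKZ` (stmt-KontsevichZagierPeriods-15044), line `eds-ds`:
# vocabulary — the double-shuffle leaf `LeafDS`

Line `eds-ds` (strategist's alternative line on the crux, skeleton
`Cruxes/HoffmanSpanInKZ/Lines/eds_ds.lean`; lead c3). ONE definition, verbatim the skeleton's, so that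
the line's registered stubs (`stub_dsLeaf_14_17`, `stub_dsTail`) can be stated under `Theorems/`:

* `LeafDS s` — the DOUBLE-SHUFFLE form of the Hoffman-spanning leaf at an admissible index `s`: one
  finitely supported `b` on Hoffman indices of the weight of `s` with `c_{bw s}(φ) = Σ_t b_t c_{bw t}(φ)`
  at every group-like solution `φ` of Racinet's generalised double shuffle with `c_y(φ) = 0`, over every
  commutative `ℚ`-algebra (no reducedness, no pentagon). For all `s` of a weight `N` this is the
  Hoffman-completeness of Ihara–Kaneko–Zagier's regularised EDS rows in weight `N` — decided mod 2 by
  the kernel-checkable engine `Literature/…/LinEDS.lean`; for ALL `N` it is IKZ 2006, Conjecture 1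
  (with Brown 2012: exactly Hoffman-completeness), OPEN.

and the two bridges from the generic Hoffman expansion of the soundness chain (files `…EdsDSLeafOfOddDet`,
`…EdsDSMasters*`: the expansion at every group-like `φ` with `c_y = 0` on which the valid rows of
weight `k` vanish): `leafDS_of_leafRows` (by E5′ `evalZ_rowZ_of_gds`: the rows DO vanish at double-shuffle
solutions) and `stub_leafDS_of_isHoffman` (a Hoffman index reduces to itself).

Sources: K. Ihara, M. Kaneko, D. Zagier, Compos. Math. 142 (2006), Thm 2, Conj. 1; G. Racinet, Publ.
Math. IHÉS 95 (2002), Def. 3.1; H. Furusho, Ann. of Math. 174 (2011), §2; F. Brown, Ann. of Math. 175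
(2012), Thm 1.1.
-/

namespace Summit.KontsevichZagierPeriods.LinRedNormalForm.HoffmanSpanInKZ

open Literature.NumberTheory.Transcendental

/-- The DOUBLE-SHUFFLE form of the Hoffman-spanning leaf at one admissible index `s`: one finitely
supported `b` on Hoffman indices of the weight of `s` with `c_{bw s}(φ) = Σ_t b_t c_{bw t}(φ)` at every
group-like solution `φ` of Racinet's generalised double shuffle with `c_{X₁}(φ) = 0`, over every
commutative `ℚ`-algebra (no reducedness, no pentagon). For all `s` of a weight `N` this is the
Hoffman-completeness of IKZ's regularised EDS rows in weight `N` (verbatim the statement of the skeleton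
`Cruxes/HoffmanSpanInKZ/Lines/eds_ds.lean`). [cite: IharaKanekoZagier2006, Conjecture 1] -/
def LeafDS (s : List ℕ) : Prop :=
  ∃ b : List ℕ →₀ ℚ, (∀ t ∈ b.support, MZV.IsHoffman t ∧ MZV.weight t = MZV.weight s) ∧
    ∀ (R : Type) [CommRing R] [Algebra ℚ R] (φ : NCSeries Bool R),
      NCSeries.IsGroupLike φ → NCSeries.GeneralisedDoubleShuffle φ → φ [true] = 0 →
        φ (MZV.binaryWord s) = b.sum (fun t q => q • φ (MZV.binaryWord t))

/-- **Bridge: the generic Hoffman expansion in weight `k = |s|` gives the double-shuffle leaf at `s`**,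
because the valid rows of every weight vanish at every group-like double-shuffle solution with `c_y = 0`
(E5′, `evalZ_rowZ_of_gds`). [cite: IharaKanekoZagier2006, Thm 2] -/
theorem leafDS_of_leafRows {k : ℕ} {s : List ℕ} (hw : MZV.weight s = k)
    (h : ∃ b : List ℕ →₀ ℚ, (∀ t ∈ b.support, MZV.IsHoffman t ∧ MZV.weight t = MZV.weight s) ∧
      ∀ (R : Type) [CommRing R] [Algebra ℚ R] (φ : NCSeries Bool R), NCSeries.IsGroupLike φ →
        φ [true] = 0 → (∀ nm : List ℕ × List ℕ, LinEDS.validName k nm = true →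
          LinEDS.evalZ φ (LinEDS.rowZ nm) = 0) →
            φ (MZV.binaryWord s) = b.sum (fun t q => q • φ (MZV.binaryWord t))) :
    LeafDS s := by
  subst hw
  obtain ⟨b, hb, h⟩ := h
  exact ⟨b, hb, fun R _ _ φ hg hds h1 => h R φ hg h1 fun nm hnm => evalZ_rowZ_of_gds hg hds h1 hnm⟩

/-- **Registered stub `stub_leafDS_of_isHoffman`** (line `eds-ds`): a Hoffman index reduces to itself
at every double-shuffle solution (`b = single s 1`). [folklore] -/
theorem stub_leafDS_of_isHoffman : ∀ s : List ℕ, MZV.IsHoffman s → LeafDS s :=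
  fun s hs => leafDS_of_leafRows (k := MZV.weight s) rfl (leafRows_of_isHoffman (MZV.weight s) hs)

end Summit.KontsevichZagierPeriods.LinRedNormalForm.HoffmanSpanInKZ
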